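import Summits.BirchSwinnertonDyer.Rank1Residual.P2.CongruentNumberSilentEvenFiveEnclosureMaximal
import Summits.BirchSwinnertonDyer.Rank1Residual.P2.CongruentNumberSilentEvenFiveEnclosureRungTwoMaximal
import Summits.BirchSwinnertonDyer.Rank1Residual.P2.CongruentNumberSilentEvenFiveRankDescent
import Literature.NumberTheory.EllipticCurves.Tian2014.CMPointSystemBridgeAut
import HarnessLib

/-!
# Cell «bsd-monsky» (typer): THE ENCLOSURE RELATIVE TO THE AUT SYSTEM FACT — C-P2-1 from ONE `2`-Selmer input
# (`hAo` Aoki 1999 Thm. 2.2 | `hMe` Heath-Brown 1994 | `h515` Monsky 1990) and `tian2014_system_sMinus_aut`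
# (the param system fact with display M4 «`T(B) = [±i]`» replaced by Tian's `T(B)` and the predicate «automorphism of
# the elliptic curve `E′_ℂ`» with five printed sentences of Tian 2014 Prop. 2.1 / J126: «`T` induced by the action of `N`
# on `ℋ ∪ ℙ¹(ℚ)`», «`T(B) ∈ Aut(E′_ℂ)` … of exact order 4», «`T(B²)` is the multiplication by `−1`», «`Aut(E′_ℂ) ≅ ℤ[i]^×`»,
# «`E′_ℂ` has complex multiplication by `ℤ[i]`»); the whole even-five two-prime family, the `k = 2` rung of C-P2-2, and
# the rank axis (clause (a) from the system fact alone) from the same fact set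

HONEST FRAMING: nothing asserted; conditional on the displayed fact `hSys⁷` (`Tian2014.tian2014_system_sMinus_aut`) and on
ONE `2`-Selmer input (plus U⁺ / GZK for the family and rung statements). Compared with the param form
(`…EnclosureParam.lean`, p457499), the sign relation `T(B) = [±i]` (M4, PROOF-A (8.1.2) second sentence, a READING of
record of referee B ROUND 253: «exact order 4» + Silverman III.10.1) is no longer displayed: it is the kernel theorem
`CMPointData.BridgeData.AutData.tianTB_of_autDisplays` of five sentences printed by Tian himself — in particular
«Now we have that `Aut(E′_ℂ) ≅ ℤ[i]^×` and `T(B) ∈ Aut(E′_ℂ)` is of order 4» (J126 L5–L7). The displayed content of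
route A's corner is now print except the one reading M5 `tyzZN` (TYZ's component rule, J747). One-line compositions
through `tian2014_system_sMinus_maximal_of_aut`; §4 adds the rank-descent twins (prover-A's p458378): clause (a), rank
one and the `Ш_an`-unit form from `hSys⁷` ALONE. Nothing booked.
-/

noncomputable section

open scoped Classical

open WeierstrassCurve Literature.NumberTheory.EllipticCurves
  Literature.NumberTheory.EllipticCurves.Monsky1990
  Literature.NumberTheory.EllipticCurves.Rank1Residual.Typed

set_option autoImplicit false

namespace Summit.BirchSwinnertonDyer.Rank1Residual.P2

open Conjectures Literature.NumberTheory.EllipticCurves.Tian2014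
  Literature.NumberTheory.EllipticCurves.HeathBrown1994
  Literature.NumberTheory.EllipticCurves.Aoki1999
  Literature.NumberTheory.EllipticCurves.Rank1Residual
  Literature.NumberTheory.EllipticCurves.TianYuanZhang2017

/-! ## §1 C-P2-1 on `𝒮⁻` from the aut system fact and one `2`-Selmer input -/

/-- **C-P2-1 relative to Aoki 1999's Selmer count and the AUT system fact** (no Cor 5.15, no HB94, no assembled point
identification, no computed cusp sentence, no displayed sign relation). Sorry-free; nothing asserted. [cite: Aoki1999, Thm. 2.2 p. 81]
[cite: Tian2014, Thm. 2.8 (J132), Def. 2.7, Prop. 2.1, p0003 L3–L5 (J119), J124–J126] [cite: TianYuanZhang2017, Thm. 3.3 (p. 739), p. 749, J733, J741, J747, J751, Lemma 3.16 (J754)]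
[cite: Miller2011LMS, Def. 1.1] -/
theorem congruentSilentEvenFiveBSDTwo_of_autSystem_of_aoki (hAo : thm22_card_selmerGroup_two)
    (hSys : tian2014_system_sMinus_aut) : CongruentSilentEvenFiveBSDTwo :=
  congruentSilentEvenFiveBSDTwo_of_maximalSystem_of_aoki hAo (tian2014_system_sMinus_maximal_of_aut hSys)

/-- **C-P2-1, `ord` form, relative to Aoki 1999's Selmer count and the AUT system fact.** Sorry-free; nothing asserted.
[cite: Aoki1999, Thm. 2.2 p. 81] [cite: Tian2014, Thm. 2.8 (J132), Def. 2.7, Prop. 2.1, p0003 L3–L5 (J119), J124–J126]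
[cite: TianYuanZhang2017, Thm. 3.3 (p. 739), p. 749, J733, J741, J747, J751, Lemma 3.16 (J754)] -/
theorem congruentSilentEvenFiveOrdTwo_of_autSystem_of_aoki (hAo : thm22_card_selmerGroup_two)
    (hSys : tian2014_system_sMinus_aut) : CongruentSilentEvenFiveOrdTwo :=
  congruentSilentEvenFiveOrdTwo_of_maximalSystem_of_aoki hAo (tian2014_system_sMinus_maximal_of_aut hSys)

/-- **C-P2-1 relative to Heath-Brown 1994's Selmer count and the AUT system fact.** Sorry-free; nothing asserted.
[cite: HeathBrown1994SelmerCongruentII, Appendix (Monsky)] [cite: Tian2014, Thm. 2.8 (J132), Def. 2.7, Prop. 2.1, p0003 L3–L5 (J119), J124–J126]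
[cite: TianYuanZhang2017, Thm. 3.3 (p. 739), p. 749, J733, J741, J747, J751, Lemma 3.16 (J754)] [cite: Miller2011LMS, Def. 1.1] -/
theorem congruentSilentEvenFiveBSDTwo_of_autSystem_of_monskyEven (hMe : monsky_card_selmerGroup_two_even)
    (hSys : tian2014_system_sMinus_aut) : CongruentSilentEvenFiveBSDTwo :=
  congruentSilentEvenFiveBSDTwo_of_maximalSystem_of_monskyEven hMe (tian2014_system_sMinus_maximal_of_aut hSys)

/-- **C-P2-1 relative to Monsky 1990 Cor. 5.15 and the AUT system fact.** Sorry-free; nothing asserted.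
[cite: Monsky1990MockHeegner, Cor. 5.15 (p. 66), Remark (2) (p. 67)] [cite: Tian2014, Thm. 2.8 (J132), Def. 2.7, Prop. 2.1, p0003 L3–L5 (J119), J124–J126]
[cite: TianYuanZhang2017, Thm. 3.3 (p. 739), p. 749, J733, J741, J747, J751, Lemma 3.16 (J754)] [cite: Miller2011LMS, Def. 1.1] -/
theorem congruentSilentEvenFiveBSDTwo_of_autSystem
    (h515 : cor515_rank_eq_one_and_card_selmerGroup_two) (hSys : tian2014_system_sMinus_aut) :
    CongruentSilentEvenFiveBSDTwo :=
  congruentSilentEvenFiveBSDTwo_of_maximalSystem h515 (tian2014_system_sMinus_maximal_of_aut hSys)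

/-! ## §2 The whole even-five two-prime family, no Rédei–Reichardt binder -/

/-- **`BSD(E_{2pq}, 2)` for ALL primes `p ≡ 5 (mod 8)`, `q ≡ 3 (mod 4)` from `{hTYZ, hGZK, hAo, hSys⁷}`** — TYZ §3
data, GZK, Aoki's refereed count and the aut system fact; no Monsky 1990, no Heath-Brown 1994, no Rédei–Reichardt
binder, no assembled, computed or sign-relation sentence (neither `f = ±ϕ` nor `T(B) = [±i]`). Conditional; nothing asserted.
[cite: TianYuanZhang2017, Thm. 1.2, Thm. 3.3, Thm. 3.5 and §1 (1.1), J733, J741, Lemma 3.16 (J754)] [cite: Aoki1999, Thm. 2.2 p. 81]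
[cite: Tian2014, Thm. 2.8 (J132), Def. 2.7, Prop. 2.1, p0003 L3–L5 (J119), J124–J126] [cite: Miller2011LMS, Def. 1.1] -/
theorem forall_bsdp_two_congruentNumberCurve_two_mul_five_mul_of_autSystem_of_aoki
    (hTYZ : tyz_genusPointData) (hGZK : rank_eq_analyticRank_of_analyticRank_le_one)
    (hAo : thm22_card_selmerGroup_two) (hSys : tian2014_system_sMinus_aut) :
    ∀ p q : ℕ, p.Prime → q.Prime → p % 8 = 5 → q % 4 = 3 →
      BSDp (congruentNumberCurve (2 * (p * q))) 2 :=
  forall_bsdp_two_congruentNumberCurve_two_mul_five_mul_of_maximalSystem_of_aoki hTYZ hGZK hAo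
    (tian2014_system_sMinus_maximal_of_aut hSys)

/-- **`BSD(E_{2pq}, 2)` for ALL primes `p ≡ 5 (mod 8)`, `q ≡ 3 (mod 4)` from `{hTYZ, hGZK, hMe, hSys⁷}`.** Conditional;
nothing asserted. [cite: TianYuanZhang2017, Thm. 1.2, Thm. 3.3, Thm. 3.5 and §1 (1.1), J733, J741, Lemma 3.16 (J754)]
[cite: HeathBrown1994SelmerCongruentII, Appendix (Monsky)] [cite: Tian2014, Thm. 2.8 (J132), Def. 2.7, Prop. 2.1, p0003 L3–L5 (J119), J124–J126] [cite: Miller2011LMS, Def. 1.1] -/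
theorem forall_bsdp_two_congruentNumberCurve_two_mul_five_mul_of_autSystem_of_monskyEven
    (hTYZ : tyz_genusPointData) (hGZK : rank_eq_analyticRank_of_analyticRank_le_one)
    (hMe : monsky_card_selmerGroup_two_even) (hSys : tian2014_system_sMinus_aut) :
    ∀ p q : ℕ, p.Prime → q.Prime → p % 8 = 5 → q % 4 = 3 →
      BSDp (congruentNumberCurve (2 * (p * q))) 2 :=
  forall_bsdp_two_congruentNumberCurve_two_mul_five_mul_of_maximalSystem_of_monskyEven hTYZ hGZK hMe
    (tian2014_system_sMinus_maximal_of_aut hSys)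

/-! ## §3 The `k = 2` rung of C-P2-2 from the aut system fact and Aoki's count -/

/-- **THE SILENT `k = 2` RUNG from {`hAo`, `hSys⁷`}.** Conditional; nothing asserted.
[cite: Aoki1999, Thm. 2.2 p. 81] [cite: Tian2014, Thm. 2.8 (J132), Def. 2.7, Prop. 2.1, p0003 L3–L5 (J119), J124–J126] [cite: TianYuanZhang2017, J733, J741, Lemma 3.16 (J754)]
[cite: Monsky1990MockHeegner, Remark (3) (p. 67)] -/
theorem congruentSilentEvenBSDTwoAt_two_of_autSystem_of_aoki (hAo : thm22_card_selmerGroup_two)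
    (hSys : tian2014_system_sMinus_aut) : CongruentSilentEvenBSDTwoAt 2 :=
  congruentSilentEvenBSDTwoAt_two_of_maximalSystem_of_aoki hAo (tian2014_system_sMinus_maximal_of_aut hSys)

/-- **THE `k = 2` RUNG `CongruentEvenBSDTwoAt 2` from {U⁺, GZK, `hAo`, `hSys⁷`}.** Conditional; nothing asserted.
[cite: Aoki1999, Thm. 2.2 p. 81] [cite: TianYuanZhang2017, Thm. 1.2, Thm. 3.3, Thm. 3.5, J733, J741, Lemma 3.16 (J754)]
[cite: Tian2014, Thm. 2.8 (J132), Def. 2.7, Prop. 2.1, p0003 L3–L5 (J119), J124–J126] [cite: Monsky1990MockHeegner, Remark (3) (p. 67)] [cite: Miller2011LMS, Def. 1.1] -/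
theorem congruentEvenBSDTwoAt_two_of_autSystem_of_aoki
    (hU : ∀ (n : ℕ), Squarefree n → (n % 8 = 5 ∨ n % 8 = 6 ∨ n % 8 = 7) →
      ∃ L : ℤ, IsScriptL n L ∧
        ((n % 8 = 5 ∨ n % 8 = 7) → (2 : ℤ) ∣ L →
          Even (genusSum₁ n fun d => genusClassNumber (GenusField d)) ∧
          Even (genusSum₂' n fun d => genusClassNumber (GenusField d))) ∧
        (n % 8 = 6 → (2 : ℤ) ∣ L → Even (genusSum₂' n fun d => genusClassNumber (GenusField d))))
    (hGZK : rank_eq_analyticRank_of_analyticRank_le_one) (hAo : thm22_card_selmerGroup_two)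
    (hSys : tian2014_system_sMinus_aut) : CongruentEvenBSDTwoAt 2 :=
  congruentEvenBSDTwoAt_two_of_maximalSystem_of_aoki hU hGZK hAo (tian2014_system_sMinus_maximal_of_aut hSys)

/-- **THE `k = 2` RUNG, SHARPER FORM `CongruentEvenOrdTwoAt 2` from {U⁺, GZK, `hAo`, `hSys⁷`}.** Conditional;
nothing asserted. [cite: Aoki1999, Thm. 2.2 p. 81] [cite: TianYuanZhang2017, §1 (1.1), Thm. 3.3, J733, J741, Lemma 3.16 (J754)]
[cite: Tian2014, Def. 2.7, Prop. 2.1, p0003 L3–L5 (J119), J124–J126] [cite: Monsky1990MockHeegner, Remark (3) (p. 67)] -/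
theorem congruentEvenOrdTwoAt_two_of_autSystem_of_aoki
    (hU : ∀ (n : ℕ), Squarefree n → (n % 8 = 5 ∨ n % 8 = 6 ∨ n % 8 = 7) →
      ∃ L : ℤ, IsScriptL n L ∧
        ((n % 8 = 5 ∨ n % 8 = 7) → (2 : ℤ) ∣ L →
          Even (genusSum₁ n fun d => genusClassNumber (GenusField d)) ∧
          Even (genusSum₂' n fun d => genusClassNumber (GenusField d))) ∧
        (n % 8 = 6 → (2 : ℤ) ∣ L → Even (genusSum₂' n fun d => genusClassNumber (GenusField d))))
    (hGZK : rank_eq_analyticRank_of_analyticRank_le_one) (hAo : thm22_card_selmerGroup_two)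
    (hSys : tian2014_system_sMinus_aut) : CongruentEvenOrdTwoAt 2 :=
  congruentEvenOrdTwoAt_two_of_maximalSystem_of_aoki hU hGZK hAo (tian2014_system_sMinus_maximal_of_aut hSys)

/-! ## §4 The rank axis from the aut system fact ALONE (rank-descent twins of prover-A's p458378) -/

/-- **C-P2-1, SHARPER (`Ш_an`-unit) FORM, from the aut system fact ALONE** (`hSys⁷`): clause (a) and `#Ш_an(E_{2pq})` a
`2`-adic unit on all of `𝒮⁻` with NO `2`-Selmer input (the first `2`-descent of Lagrange 1975 in the kernel and the system's
own point). Conditional; nothing asserted. [cite: Tian2014, Def. 2.7, Prop. 2.1, p0003 L3–L5 (J119), J124–J126]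
[cite: TianYuanZhang2017, Thm. 3.3, J733, J741, J747, J751, Lemma 3.16 (J754)] [cite: Lagrange1975, §11 table p. 16-12] -/
theorem congruentSilentEvenFiveOrdTwo_of_autSystem_rankDescent (hSys : tian2014_system_sMinus_aut) :
    CongruentSilentEvenFiveOrdTwo :=
  congruentSilentEvenFiveOrdTwo_of_maximalSystem_rankDescent (tian2014_system_sMinus_maximal_of_aut hSys)

/-- **Clause (a) on all of `𝒮⁻` from the aut system fact alone**: `ord_{s=1} L(E_{2pq}, s) = 1`.
[cite: TianYuanZhang2017, Thm. 1.1, Thm. 3.3] [cite: Lagrange1975, §11 table p. 16-12] -/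
theorem analyticRank_eq_one_of_autSystem_rankDescent (hSys : tian2014_system_sMinus_aut) :
    ∀ p q : ℕ, p.Prime → q.Prime → p % 8 = 5 → q % 4 = 3 → jacobiSym p q = -1 →
      (congruentNumberCurve (2 * (p * q))).analyticRank = 1 :=
  analyticRank_eq_one_of_maximalSystem_rankDescent (tian2014_system_sMinus_maximal_of_aut hSys)

/-- **Rank one on all of `𝒮⁻` from the aut system fact alone.** [cite: Lagrange1975, §11 table p. 16-12]
[cite: Monsky1990MockHeegner, Thm. 5.5 (p. 62), Thm. 5.9 (1) (pp. 63–64)] -/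
theorem mordellWeilRank_eq_one_of_autSystem_rankDescent (hSys : tian2014_system_sMinus_aut) :
    ∀ p q : ℕ, p.Prime → q.Prime → p % 8 = 5 → q % 4 = 3 → jacobiSym p q = -1 →
      (congruentNumberCurve (2 * (p * q))).mordellWeilRank = 1 :=
  mordellWeilRank_eq_one_of_maximalSystem_rankDescent (tian2014_system_sMinus_maximal_of_aut hSys)

/-- **C-P2-1 (observable form) on the corner `{hAo, hSys⁷}` with the division of labour visible**: `hSys⁷` alone gives the
sharper form; `hAo` converts `Ш_an` into `Ш`. Conditional; nothing asserted. [cite: Aoki1999, Thm. 2.2 p. 81]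
[cite: Tian2014, Def. 2.7, Prop. 2.1, p0003 L3–L5 (J119), J124–J126] [cite: TianYuanZhang2017, Thm. 3.3, J733, J741, J747, J751, Lemma 3.16 (J754)]
[cite: Miller2011LMS, Def. 1.1] -/
theorem congruentSilentEvenFiveBSDTwo_of_autSystem_of_aoki_rankDescent (hAo : thm22_card_selmerGroup_two)
    (hSys : tian2014_system_sMinus_aut) :
    CongruentSilentEvenFiveOrdTwo ∧ CongruentSilentEvenFiveBSDTwo :=
  ⟨congruentSilentEvenFiveOrdTwo_of_autSystem_rankDescent hSys,
    congruentSilentEvenFiveBSDTwo_of_autSystem_of_aoki hAo hSys⟩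

end Summit.BirchSwinnertonDyer.Rank1Residual.P2

end
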